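import Summits.RiemannHypothesis.RiemannHypothesis.Theorems.SuzukiSharpRadiusDefs
import Literature.Analysis.SpecialFunctions.EulerMascheroniBounds
import Literature.Analysis.SpecialFunctions.LogPiBounds

/-!
# SuzukiSharpRadius — S1 `XiLogDerivAtOne`: `ξ'/ξ(1) = 1 + γ/2 − ½ log 4π`, and `0 < c⋆` (column DBR; RH-FREE)

RH-FREE throughout; nothing here bears on the truth of RH.  First proof file of the cell rh-dbr's theory target T-LCR⋆
(typed in `Theorems.SuzukiSharpRadiusDefs`): the closed form behind the sharp clean-radius constant
`c⋆ = sharpCleanConst = 2 + γ − log 4π = 2·ξ'/ξ(1)`.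

* `hasDerivAt_riemannXi_one`, `deriv_riemannXi_one`: `ξ'(1) = Λ₀(1)/2` — differentiate the tree's definition
  `ξ(s) = ½ + s(s−1)/2 · Λ₀(s)` (`Literature.NumberTheory.LFunctions.riemannXi`, Mathlib's entire `completedRiemannZeta₀`);
  the factor `s(s−1)` kills `Λ₀'(1)`.
* `xiLogDerivRe_one_zero`: `Re ξ'/ξ(1) = Re Λ₀(1)` (`ξ(1) = ½`).
* `xiLogDerivAtOne` (**S1, PROVED**): with Mathlib's `completedRiemannZeta₀_one : Λ₀(1) = (γ − log 4π)/2 + 1`.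
* `sharpCleanConst_eq_two_mul` (`c⋆ = 2 ξ'/ξ(1)`), `sharpCleanConst_pos` (`0 < c⋆`), `sharpCleanConst_bounds`
  (`0.04619 < c⋆ < 0.0462`) from the tree's certified `γ ∈ (0.57721558, 0.57721571)` and `log π` to 20 digits;
  `linearCleanRadius_of_sharp : LinearCleanRadiusSharp → LinearCleanRadius` (S6 with its hypothesis discharged).

References: B. Riemann 1859 / Titchmarsh §2.1 (`ξ`); the constant `Σ_ρ 1/ρ = 1 + γ/2 − ½log 4π = 0.0230957…`
(Davenport, Multiplicative Number Theory, §12 (10)–(11)) is the same number `ξ'/ξ(1) = −B`.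
-/

noncomputable section

-- D-0017: `Summit.<S>.<S>.…` is the designed namespace of a single-problem summit.
set_option linter.dupNamespace false

open Complex

namespace Summit.RiemannHypothesis.RiemannHypothesis.Theorems.SuzukiSharpRadius

open Literature.NumberTheory.LFunctions Literature.Analysis.SpecialFunctions
open Summit.RiemannHypothesis.RiemannHypothesis.Theorems.SuzukiCleanRadius

/-- `ξ'(1) = Λ₀(1)/2`: differentiate `ξ(s) = ½ + s(s−1)/2 · Λ₀(s)` at `s = 1` (the factor `s(s−1)` kills `Λ₀'(1)`). -/
theorem hasDerivAt_riemannXi_one : HasDerivAt riemannXi (completedRiemannZeta₀ 1 / 2) 1 := by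
  have hΛ : HasDerivAt completedRiemannZeta₀ (deriv completedRiemannZeta₀ 1) 1 :=
    (differentiable_completedZeta₀ 1).hasDerivAt
  have h := ((((hasDerivAt_id (1 : ℂ)).mul ((hasDerivAt_id (1 : ℂ)).sub_const 1)).div_const 2).mul hΛ).const_add
    (1 / 2 : ℂ)
  simp only [Pi.mul_apply, id_eq] at h
  have e : (fun x : ℂ => 1 / 2 + x * (x - 1) / 2 * completedRiemannZeta₀ x) = riemannXi := by
    funext s; rfl
  rw [e] at h
  refine h.congr_deriv ?_
  ring

/-- `ξ'(1) = Λ₀(1)/2`. -/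
theorem deriv_riemannXi_one : deriv riemannXi 1 = completedRiemannZeta₀ 1 / 2 :=
  hasDerivAt_riemannXi_one.deriv

/-- `Re ξ'/ξ(1) = Re Λ₀(1)` (as `ξ(1) = ½`). -/
theorem xiLogDerivRe_one_zero : xiLogDerivRe 1 0 = (completedRiemannZeta₀ 1).re := by
  unfold xiLogDerivRe
  have h : ((1 : ℝ) : ℂ) + ((0 : ℝ) : ℂ) * I = 1 := by simp
  rw [h, deriv_riemannXi_one, riemannXi_one]
  congr 1
  field_simp

/-- **S1 `XiLogDerivAtOne`, PROVED** (RH-FREE): `ξ'/ξ(1) = 1 + γ/2 − ½ log(4π)` — via `ξ'/ξ(1) = Λ₀(1)` and Mathlib's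
`completedRiemannZeta₀_one : Λ₀(1) = (γ − log 4π)/2 + 1`. -/
theorem xiLogDerivAtOne : XiLogDerivAtOne := by
  unfold XiLogDerivAtOne
  rw [xiLogDerivRe_one_zero, completedRiemannZeta₀_one]
  have h4π : (0 : ℝ) ≤ 4 * Real.pi := by positivity
  rw [show (4 : ℂ) * (Real.pi : ℂ) = ((4 * Real.pi : ℝ) : ℂ) by push_cast; ring, ← Complex.ofReal_log h4π]
  simp only [Complex.add_re, Complex.div_ofNat_re, Complex.sub_re, Complex.ofReal_re, Complex.one_re]
  ring

/-- `c⋆ = 2·ξ'/ξ(1)`. -/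
theorem sharpCleanConst_eq_two_mul : sharpCleanConst = 2 * xiLogDerivRe 1 0 := by
  rw [xiLogDerivAtOne]
  unfold sharpCleanConst
  ring

/-- **`0 < c⋆`** (RH-FREE numerics): `c⋆ = 2 + γ − log(4π) > 0`, from the tree's certified
`γ > 0.57721558` and `log π < 1.1447298858…` (`log 4π = 2 log 2 + log π`, `log 2 < 0.6931471808`). -/
theorem sharpCleanConst_pos : 0 < sharpCleanConst := by
  unfold sharpCleanConst
  have hγ := Real.eulerMascheroniConstant_gt_d8
  have hπ := Real.log_pi_lt_d20
  have h2 := Real.log_two_lt_d9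
  have h4 : Real.log (4 * Real.pi) = 2 * Real.log 2 + Real.log Real.pi := by
    rw [Real.log_mul (by norm_num) Real.pi_pos.ne', show (4 : ℝ) = 2 ^ 2 by norm_num, Real.log_pow]
    push_cast; ring
  rw [h4]
  linarith

/-- Numerical enclosure of the sharp constant (RH-FREE): `0.04619 < c⋆ < 0.0462`. -/
theorem sharpCleanConst_bounds : 0.04619 < sharpCleanConst ∧ sharpCleanConst < 0.0462 := by
  unfold sharpCleanConst
  have hγ₁ := Real.eulerMascheroniConstant_gt_d8
  have hγ₂ := Real.eulerMascheroniConstant_lt_d8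
  have hπ₁ := Real.log_pi_lt_d20
  have hπ₂ := Real.log_pi_gt_d20
  have h2₁ := Real.log_two_lt_d9
  have h2₂ := Real.log_two_gt_d9
  have h4 : Real.log (4 * Real.pi) = 2 * Real.log 2 + Real.log Real.pi := by
    rw [Real.log_mul (by norm_num) Real.pi_pos.ne', show (4 : ℝ) = 2 ^ 2 by norm_num, Real.log_pow]
    push_cast; ring
  rw [h4]
  constructor <;> linarith

/-- **S6 discharged** (RH-FREE): the sharp radius implies the landed `LinearCleanRadius` (take `c = c⋆/2 > 0`). -/
theorem linearCleanRadius_of_sharp (h : LinearCleanRadiusSharp) : LinearCleanRadius :=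
  sharpImpliesLinear sharpCleanConst_pos h

end Summit.RiemannHypothesis.RiemannHypothesis.Theorems.SuzukiSharpRadius

end
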